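import Summits.QuantumFields.BalabanUV.Beta.D1BFx.PackedLettersAtSites

/-!
# `BalabanUV.Beta.D1BFx.PackedLettersBlockCov` — road «BF-x» for binder row D1, slot (K), chain step (I) «(A1)-PACKED», brick «BLOCK-COV»
# (FINDING F-g18-1, owner): **THE FIRST-ORDER DICTIONARY CHAIN UNDER BLOCK-TRANSLATION COVARIANCE ONLY.**  (B4) `arr_wsum_eq_sum_window` ∕ `arr_vertexOfK`,
# (B4c) `blocksHat_sortK_arr_vertexOfK`, PART 3a §1 `packed_first_letter_site` ∕ `ffHat∕mfHat_packed_site` display FULL fine-translation covariance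
# `∀ κ′ u v, S κ′ (u + v) = shiftK (−v) (S κ′ u)` of the stencil family, but USE it only under PERIOD translations `(n·p)•m`; the chart-(III′) literal's tables are
# BLOCK-translation covariant only (an1's `SymAveragingHessianCounts.symVhSAt_translate` ∕ `symHessFFAt_translate`: multiples of the block side `n`).
# This file re-states the chain with the hypothesis the literal inhabits — PERIOD covariance `K (u + s•m) = shiftK (−(s•m)) (K u)` for the `ℤ^D` lemmas,
# BLOCK covariance `S κ′ (u + n•t) = shiftK (−(n•t)) (S κ′ u)` for the torus letters (period multiples `(n·p)•m = n•(p•m)`) — proofs VERBATIM otherwise.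

HONEST DEPENDENCY (cell records, verbatim): «continuum YM on T⁴ ⇐ BetaPertH ∧ nine spine estimates (0/9 proved); BetaPertH ⇐ (D1) ∧ (D4) ∧
CAP+tail; G-an2-4 gates asym, D1 and NE2/3/4.»  HONEST FRAMING (cell contract, verbatim): «discharging `BetaPertH` makes Bałaban's UV stability
UNCONDITIONAL — a real constructive-QFT result; it is NOT the continuum limit and NOT the Clay problem.»  THIS MODULE DISCHARGES NOTHING of (K),
of D1 or of the wall: [folklore] bookkeeping BY NAME ((B4) `PeriodicArraySuperposition`, (B4c) `PeriodicArraySuperpositionTorus`, PART 1c, PART 3a with ONE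
hypothesis weakened).  No definition, no `def … : Prop`, nothing cited, 0 sorry.  0 root-level binders of row D1 discharged; (K) NOT closed; NOT D1, NOT
`BetaPertH`, NOT continuum, NOT Clay.

ABSOLUTE RULE (cell charter, verbatim): «No internally-minted statement may enter as a cited fact. Every hypothesis is either kernel-proved in this
package or a verbatim quotation of a PUBLISHED theorem with page reference. The manuscript(s) under audit are NOT citable for their own disputed
steps — they are the thing under adjudication; programme-internal (2001/route/tribunal) claims are never citable.»

CONTENT (all [folklore]).
* §1 (`ℤ^D`, period `s`) `arr_translate_eq_of_period`, **`arr_wsum_eq_sum_window_of_period`**, **`arr_vertexOfK_of_period`** — (B4) under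
  `hKcov : ∀ u m, K (imageShift s u m) = shiftK (−((s:ℤ)•m)) (K u)`.
* §2 (torus `n, p`) `period_cov_of_block` (block ⇒ period covariance), **`blocksHat_sortK_arr_vertexOfK_of_block`** — (B4c) under
  `hScovB : ∀ κ′ u t, S κ′ (u + (n:ℤ)•t) = shiftK (−((n:ℤ)•t)) (S κ′ u)`.
* §3 (the road's pack `G₀`) **`packed_first_letter_site_of_block`**, **`ffHat_packed_site_of_block`**, **`mfHat_packed_site_of_block`** — PART 3a §1 under `hScovB`;
  `period₂_cov_of_block` (the second-order period form of PART 1∕3a §2 from BLOCK-joint covariance).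
Unit `b2b-balaban-beta-d1-p2` (road owner, gen 18), 2026-08-22.
-/

noncomputable section

namespace Summit.QuantumFields.BalabanUV.Beta.D1BFx.PackedLettersBlockCov

open Matrix
open scoped BigOperators
open Literature.Probability.LatticeModels (TorusSite)
open Literature.MathematicalPhysics.QuantumFieldTheory.Balaban1983to89
open Literature.MathematicalPhysics.QuantumFieldTheory.Balaban1983to89.Beta
open Literature.MathematicalPhysics.QuantumFieldTheory.Balaban1983to89.Beta.Composition (kkt)
open B12Sec2to5 (l1 l1_nonneg)
open ExpKernelCalculus (MKer BiLoc Decays shiftK Zl)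
open AffineAveraging (box toSite)
open OneStepResolventKernel (Fib wsum LocStencil bound_mono biLoc_wsum)
open OneStepKernelFamily (KInvStep colH vertexOfK abs_colH_le)
open Summit.QuantumFields.BalabanUV.Beta.AxialDressingRooted (coDressKBmAt decays_coDressKBmAt_KInvStep)
open Summit.QuantumFields.BalabanUV.Beta.D1BFx.FibredPeriodisation (periodiseF)
open Summit.QuantumFields.BalabanUV.Beta.D1BFx.SortedKernels (blocksHat fTL fBL)
open Summit.QuantumFields.BalabanUV.Beta.D1BFx.SortedReblocking (torusBlockEquiv)
open Summit.QuantumFields.BalabanUV.Beta.D1BFx.SortedPack (sortK)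
open Summit.QuantumFields.BalabanUV.Beta.D1BFx.TorusCombKKT (I J CombRows tauT Khat Qhat)
open Summit.QuantumFields.BalabanUV.Beta.D1BFx.PeriodicArrays (arr arr_apply imageShift_eq_add_smul)
open Summit.QuantumFields.BalabanUV.Beta.D1BFx.PeriodicArraySuperposition (arr_shiftK_period arr_finset_sum_apply arr_wsum_apply summable_wsum_arr)
open Summit.QuantumFields.BalabanUV.Beta.D1BFx.PeriodicArraySuperpositionTorus (blocksHat_sortK_finset_sum summable_images_arr)
open Summit.QuantumFields.BalabanUV.Beta.D1BFx.PackedDictionaryLetters (locStencil_mono)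
open Summit.QuantumFields.BalabanUV.Beta.D1BFx.PackedBlockGlue (blocks_of_blocksHat_eq_sum response_siteOf_eq_tsum_colH)

variable {D : ℕ} {F : Type*}

/-! ## §1 `ℤ^D`: the window sum under PERIOD covariance -/

section Period

/-- [folklore] One array per residue class, from covariance under PERIOD translations only. -/
theorem arr_translate_eq_of_period {K : ExpKernelCalculus.Site D → MKer D F} (s : ℕ)
    (hK : ∀ u m, K (imageShift s u m) = shiftK (-((s : ℤ) • m)) (K u)) (u m : ExpKernelCalculus.Site D) :
    arr s (K (imageShift s u m)) = arr s (K u) := by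
  rw [hK u m, show -((s : ℤ) • m) = (s : ℤ) • (-m) by rw [smul_neg], arr_shiftK_period]

variable {w : ExpKernelCalculus.Site D → ℝ} {K : ExpKernelCalculus.Site D → MKer D F} {C Ck δ : ℝ} {p : ExpKernelCalculus.Site D}

/-- [folklore] **(B4) UNDER PERIOD COVARIANCE**: `arr s (wsum w K) x y a b = Σ_{z : Site D s} (Σ'_m w (ẑ + s·m)) · arr s (K ẑ) x y a b` for decaying weights, self-localised
stencils, and `K (u + s•m) = shiftK (−(s•m)) (K u)` — the proof of `PeriodicArraySuperposition.arr_wsum_eq_sum_window` VERBATIM with the one covariance call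
weakened. -/
theorem arr_wsum_eq_sum_window_of_period (hw : ∀ u, |w u| ≤ C * Real.exp (-δ * l1 (u - p))) (hK : ∀ u, BiLoc (K u) u u Ck δ)
    (s : ℕ) [NeZero s] (hKcov : ∀ u m, K (imageShift s u m) = shiftK (-((s : ℤ) • m)) (K u)) (hδ : 0 < δ) (hC : 0 ≤ C)
    (x y : ExpKernelCalculus.Site D) (a b : F) :
    arr s (wsum w K) x y a b
      = ∑ z : Beta.Site D s, (∑' m : ExpKernelCalculus.Site D, w (imageShift s (windowMap D s z) m)) * arr s (K (windowMap D s z)) x y a b := by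
  rw [arr_wsum_apply hw hK hδ hC s x y a b, tsum_eq_sum_tsum_imageShift (s := s) (summable_wsum_arr hw hK hδ s x y a b)]
  refine Finset.sum_congr rfl fun z _ => ?_
  rw [← tsum_mul_right]
  exact tsum_congr fun m => by rw [arr_translate_eq_of_period s hKcov]

end Period

section VertexPeriod

variable {d n : ℕ}

/-- [folklore] **(B4) FOR THE CHAIN-RULE VERTEX UNDER PERIOD COVARIANCE** (`PeriodicArraySuperposition.arr_vertexOfK` with `hScov` weakened to
`∀ κ′ u m, S κ′ (u + s•m) = shiftK (−(s•m)) (S κ′ u)`). -/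
theorem arr_vertexOfK_of_period {K : MKer (d + 1) (Fib d)} {C δK : ℝ} (hK : Decays K C δK) (hC : 0 ≤ C)
    {S : Fin (d + 1) → ExpKernelCalculus.Site (d + 1) → MKer (d + 1) (Fib d)} {Cs δ : ℝ}
    (hS : LocStencil S Cs δ) (hδ : 0 < δ) (hδK : δ ≤ δK) (s : ℕ) [NeZero s]
    (hScov : ∀ κ' u m, S κ' (imageShift s u m) = shiftK (-((s : ℤ) • m)) (S κ' u))
    (μ : Fin (d + 1)) (y x z : ExpKernelCalculus.Site (d + 1)) (a b : Fib d) :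
    arr s (vertexOfK K n S μ y) x z a b
      = ∑ κ' : Fin (d + 1), ∑ zz : Beta.Site (d + 1) s,
          (∑' m : ExpKernelCalculus.Site (d + 1), colH K n μ y κ' (imageShift s (windowMap (d + 1) s zz) m))
            * arr s (S κ' (windowMap (d + 1) s zz)) x z a b := by
  have hw : ∀ κ' : Fin (d + 1), ∀ u, |colH K n μ y κ' u| ≤ C * Real.exp (-δ * l1 (u - (n : ℤ) • y)) :=
    fun κ' u => bound_mono (abs_colH_le (N := n) hK μ y κ' u) hC le_rfl hδK (l1_nonneg _)
  have hterm : ∀ κ' ∈ (Finset.univ : Finset (Fin (d + 1))),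
      BiLoc (wsum (colH K n μ y κ') (S κ')) ((n : ℤ) • y) ((n : ℤ) • y) (C * Cs * Zl (d + 1) (δ / 2)) (δ / 2) :=
    fun κ' _ => biLoc_wsum (hw κ') (fun u => hS κ' u) hδ hC
  have h1 : arr s (vertexOfK K n S μ y) x z a b = ∑ κ' : Fin (d + 1), arr s (wsum (colH K n μ y κ') (S κ')) x z a b := by
    have e : vertexOfK K n S μ y = fun x z a b => ∑ κ' ∈ (Finset.univ : Finset (Fin (d + 1))), wsum (colH K n μ y κ') (S κ') x z a b := rfl
    rw [e, arr_finset_sum_apply Finset.univ hterm (half_pos hδ) s x z a b]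
  rw [h1]
  exact Finset.sum_congr rfl fun κ' _ => arr_wsum_eq_sum_window_of_period (hw κ') (fun u => hS κ' u) s (hScov κ') hδ hC x z a b

end VertexPeriod

/-! ## §2 The torus: (B4c) under BLOCK covariance -/

section Block

variable {d n p : ℕ} [NeZero n] [NeZero p]

omit [NeZero n] [NeZero p] in
/-- [folklore] **BLOCK ⇒ PERIOD COVARIANCE**: covariance under the block translations `n•t` gives covariance under every period translate `(n·p)•m = n•(p•m)`. -/
theorem period_cov_of_block {S : Fin (d + 1) → ExpKernelCalculus.Site (d + 1) → MKer (d + 1) (Fib d)}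
    (hScovB : ∀ κ' u t, S κ' (u + (n : ℤ) • t) = shiftK (-((n : ℤ) • t)) (S κ' u)) (κ' : Fin (d + 1)) (u m : ExpKernelCalculus.Site (d + 1)) :
    S κ' (imageShift (n * p) u m) = shiftK (-(((n * p : ℕ) : ℤ) • m)) (S κ' u) := by
  have e : (((n * p : ℕ) : ℤ) • m) = (n : ℤ) • ((p : ℤ) • m) := by rw [Nat.cast_mul, mul_smul]
  rw [imageShift_eq_add_smul, e]
  exact hScovB κ' u ((p : ℤ) • m)

/-- [folklore] **(B4c) «PACKED-DICT-HAT» UNDER BLOCK COVARIANCE** — `PeriodicArraySuperpositionTorus.blocksHat_sortK_arr_vertexOfK` with `hScov` weakened to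
`hScovB : ∀ κ′ u t, S κ′ (u + n•t) = shiftK (−(n•t)) (S κ′ u)`:
`blocksHat p (sortK n (arr (n·p) (vertexOfK K n S μ ŷ))) = Σ_{k : I d n p} (Σ'_m colH K n μ ŷ κ′_k (ŵ_k + (n·p)·m)) • blocksHat p (sortK n (arr (n·p) (S κ′_k ŵ_k)))`. -/
theorem blocksHat_sortK_arr_vertexOfK_of_block {K : MKer (d + 1) (Fib d)} {C δK : ℝ} (hK : Decays K C δK) (hC : 0 ≤ C)
    {S : Fin (d + 1) → (Fin (d + 1) → ℤ) → MKer (d + 1) (Fib d)} {Cs δ : ℝ}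
    (hS : LocStencil S Cs δ) (hδ : 0 < δ) (hδK : δ ≤ δK) (hScovB : ∀ κ' u t, S κ' (u + (n : ℤ) • t) = shiftK (-((n : ℤ) • t)) (S κ' u))
    (μ : Fin (d + 1)) (yhat : Fin (d + 1) → ℤ) :
    blocksHat p (sortK n (arr (n * p) (vertexOfK K n S μ yhat)))
      = ∑ k : Beta.Site (d + 1) p × (TorusSite (d + 1) n × Fin (d + 1)),
          (∑' m : Fin (d + 1) → ℤ, colH K n μ yhat k.2.2 (imageShift (n * p) (windowMap (d + 1) (n * p) (torusBlockEquiv n p (k.1, k.2.1))) m))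
            • blocksHat p (sortK n (arr (n * p) (S k.2.2 (windowMap (d + 1) (n * p) (torusBlockEquiv n p (k.1, k.2.1)))))) := by
  let e : Beta.Site (d + 1) p × (TorusSite (d + 1) n × Fin (d + 1)) ≃ Fin (d + 1) × Beta.Site (d + 1) (n * p) :=
    { toFun := fun k => (k.2.2, torusBlockEquiv n p (k.1, k.2.1))
      invFun := fun q => (((torusBlockEquiv n p).symm q.2).1, (((torusBlockEquiv n p).symm q.2).2, q.1))
      left_inv := fun k => by simp
      right_inv := fun q => by simp }
  have hB4 : arr (n * p) (vertexOfK K n S μ yhat) = fun x z a b =>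
      ∑ k : Beta.Site (d + 1) p × (TorusSite (d + 1) n × Fin (d + 1)),
        (∑' m : Fin (d + 1) → ℤ, colH K n μ yhat k.2.2 (imageShift (n * p) (windowMap (d + 1) (n * p) (torusBlockEquiv n p (k.1, k.2.1))) m))
          * arr (n * p) (S k.2.2 (windowMap (d + 1) (n * p) (torusBlockEquiv n p (k.1, k.2.1)))) x z a b := by
    funext x z a b
    rw [arr_vertexOfK_of_period (n := n) hK hC hS hδ hδK (n * p) (period_cov_of_block hScovB) μ yhat x z a b, ← Fintype.sum_prod_type']
    exact (Fintype.sum_equiv e _ (fun q : Fin (d + 1) × Beta.Site (d + 1) (n * p) =>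
      (∑' m : Fin (d + 1) → ℤ, colH K n μ yhat q.1 (imageShift (n * p) (windowMap (d + 1) (n * p) q.2) m))
        * arr (n * p) (S q.1 (windowMap (d + 1) (n * p) q.2)) x z a b) (fun k => rfl)).symm
  rw [hB4]
  exact blocksHat_sortK_finset_sum Finset.univ _ _ fun k _ a b x w =>
    summable_images_arr (hS k.2.2 _) hδ (n * p) a b x w

end Block

/-! ## §3 The road's pack `G₀`: PART 3a §1 under BLOCK covariance; the second-order period form -/

section Road

variable {d : ℕ} {n : ℕ} [NeZero n] {r : Fin (d + 1) → ℕ} (hr : r ∈ box (d + 1) n) (p : ℕ) [NeZero p]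
include hr

/-- [folklore] **PART 3a's FIRST-ORDER LETTER AT A COARSE SITE UNDER BLOCK COVARIANCE**:
`(arr (n·p) (vertexOfK G₀ n S μ y))ˆ = Σ_{k : I d n p} M_T⁻¹ (inl k) (inr (inl (siteOf p y, μ))) • (arr (n·p) (S κ′_k ŵ_k))ˆ`. -/
theorem packed_first_letter_site_of_block {S : Fin (d + 1) → (Fin (d + 1) → ℤ) → MKer (d + 1) (Fib d)} {Cs δ : ℝ} (hS : LocStencil S Cs δ) (hCs : 0 ≤ Cs)
    (hδ : 0 < δ) (hScovB : ∀ κ' u t, S κ' (u + (n : ℤ) • t) = shiftK (-((n : ℤ) • t)) (S κ' u)) (y : Fin (d + 1) → ℤ) (μ : Fin (d + 1)) :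
    blocksHat p (sortK n (arr (n * p) (vertexOfK (coDressKBmAt (toSite r) n (KInvStep (d := d) n 0)) n S μ y)))
      = ∑ k : I d n p,
          (kkt (Khat (d := d) n p) (Matrix.fromRows (Qhat (d := d) n p) (tauT (toSite r) n p)))⁻¹ (Sum.inl k) (Sum.inr (Sum.inl (siteOf (d + 1) p y, μ)))
            • blocksHat p (sortK n (arr (n * p) (S k.2.2 (windowMap (d + 1) (n * p) (torusBlockEquiv n p (k.1, k.2.1)))))) := by
  obtain ⟨δG, CG, hδG, hCG, hG⟩ := decays_coDressKBmAt_KInvStep (d := d) hr 0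
  rw [blocksHat_sortK_arr_vertexOfK_of_block hG hCG (locStencil_mono hS hCs (min_le_left δ δG)) (lt_min hδ hδG) (min_le_right δ δG) hScovB μ y]
  refine Finset.sum_congr rfl fun k _ => ?_
  rw [response_siteOf_eq_tsum_colH hr p y μ k]

/-- [folklore] **THE ff BLOCK AT A COARSE SITE IS PACKED** (block covariance). -/
theorem ffHat_packed_site_of_block {S : Fin (d + 1) → (Fin (d + 1) → ℤ) → MKer (d + 1) (Fib d)} {Cs δ : ℝ} (hS : LocStencil S Cs δ) (hCs : 0 ≤ Cs)
    (hδ : 0 < δ) (hScovB : ∀ κ' u t, S κ' (u + (n : ℤ) • t) = shiftK (-((n : ℤ) • t)) (S κ' u)) (y : Fin (d + 1) → ℤ) (μ : Fin (d + 1)) :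
    Matrix.of (periodiseF p (fTL (sortK n (arr (n * p) (vertexOfK (coDressKBmAt (toSite r) n (KInvStep (d := d) n 0)) n S μ y)))))
      = ∑ k : I d n p,
          (kkt (Khat (d := d) n p) (Matrix.fromRows (Qhat (d := d) n p) (tauT (toSite r) n p)))⁻¹ (Sum.inl k) (Sum.inr (Sum.inl (siteOf (d + 1) p y, μ)))
            • Matrix.of (periodiseF p (fTL (sortK n (arr (n * p) (S k.2.2 (windowMap (d + 1) (n * p) (torusBlockEquiv n p (k.1, k.2.1)))))))) :=
  (blocks_of_blocksHat_eq_sum p _ _ _ (packed_first_letter_site_of_block hr p hS hCs hδ hScovB y μ)).1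

/-- [folklore] **THE mf BLOCK AT A COARSE SITE IS PACKED** (block covariance). -/
theorem mfHat_packed_site_of_block {S : Fin (d + 1) → (Fin (d + 1) → ℤ) → MKer (d + 1) (Fib d)} {Cs δ : ℝ} (hS : LocStencil S Cs δ) (hCs : 0 ≤ Cs)
    (hδ : 0 < δ) (hScovB : ∀ κ' u t, S κ' (u + (n : ℤ) • t) = shiftK (-((n : ℤ) • t)) (S κ' u)) (y : Fin (d + 1) → ℤ) (μ : Fin (d + 1)) :
    Matrix.of (periodiseF p (fBL (sortK n (arr (n * p) (vertexOfK (coDressKBmAt (toSite r) n (KInvStep (d := d) n 0)) n S μ y)))))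
      = ∑ k : I d n p,
          (kkt (Khat (d := d) n p) (Matrix.fromRows (Qhat (d := d) n p) (tauT (toSite r) n p)))⁻¹ (Sum.inl k) (Sum.inr (Sum.inl (siteOf (d + 1) p y, μ)))
            • Matrix.of (periodiseF p (fBL (sortK n (arr (n * p) (S k.2.2 (windowMap (d + 1) (n * p) (torusBlockEquiv n p (k.1, k.2.1)))))))) :=
  (blocks_of_blocksHat_eq_sum p _ _ _ (packed_first_letter_site_of_block hr p hS hCs hδ hScovB y μ)).2.2.1

omit [NeZero n] [NeZero p] hr in
/-- [folklore] **BLOCK-JOINT ⇒ PERIOD-JOINT COVARIANCE** (the second-order period form of PART 1∕3a §2, (B4e)): joint covariance of the pair stencils under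
the block translations `n•t` gives it under every period translate `(n·p)•m`. -/
theorem period₂_cov_of_block {S₂ : Fin (d + 1) → (Fin (d + 1) → ℤ) → Fin (d + 1) → (Fin (d + 1) → ℤ) → MKer (d + 1) (Fib d)}
    (hS₂covB : ∀ κ' κ'' u u' t, S₂ κ' (u + (n : ℤ) • t) κ'' (u' + (n : ℤ) • t) = shiftK (-((n : ℤ) • t)) (S₂ κ' u κ'' u'))
    (κ' κ'' : Fin (d + 1)) (u u' m : Fin (d + 1) → ℤ) :
    S₂ κ' (imageShift (n * p) u m) κ'' (imageShift (n * p) u' m) = shiftK (-(((n * p : ℕ) : ℤ) • m)) (S₂ κ' u κ'' u') := by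
  have e : (((n * p : ℕ) : ℤ) • m) = (n : ℤ) • ((p : ℤ) • m) := by rw [Nat.cast_mul, mul_smul]
  rw [imageShift_eq_add_smul, imageShift_eq_add_smul, e]
  exact hS₂covB κ' κ'' u u' ((p : ℤ) • m)

end Road

end Summit.QuantumFields.BalabanUV.Beta.D1BFx.PackedLettersBlockCov

end
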